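/-
Copyright (c) 2026 the pub-hodgecm-mathlib formalisation cell (harness21).  Prover seat hodgecm-mathlib-A-p19 (g29): road «S3-ram» (LEAD F0P3a-plan (g13); owner ∕ (α) keeper
F0P3a-p06 (g16); (Cnt2′) chair F0P3a-p07 (g15), RULING (13)(2)), organ **«J2-FRAME-hyp»**: the HYPERBOLIC type-(2) literal `ι(g, u)` CENTRED by its `1 × 1` block AND RE-ROOTED
by an axis frame — generic valued-field part; 2026-09-02.
-/
import Literature.NumberTheory.Automorphic.UnitaryLatticeTreeBlockLiteralCentring        -- ★ p849074 (F0P3-p01 (g19)): centring `s·ι(γ₁,u)`, `coe_scalar_mul_eq_smul`, `scalar_mul_mem_unitaryGroupOfForm`, §5 five-strata SET equality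
import Literature.NumberTheory.Automorphic.UnitaryLatticeTreeCountsClassFunction        -- ★ (F0P3a-p07): `ncard_selfDual_fixed_{bd,deep,reg,rankOne,rankOneNot}_conj_eq_of_mem_unitaryGroupOfForm`
import Literature.NumberTheory.Automorphic.UnitaryLatticeTreeBlockFixedBounded          -- ★ p848759 (A-p19 (g28)): `finite_setOf_latticeGraphIso_antidiagonal_eq_of_coe_eq_conj_endoGL`
import Literature.NumberTheory.Automorphic.UnitaryLatticeTreeAnisotropicAxisCount       -- ★ (F0P3a-p07): brings `map_sub_one_latt_le_scaleLattice_iff`, `latt_one`, `isIntMatrix_of_forall_v_sub_one_lt_one`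
import Literature.NumberTheory.Automorphic.UnitaryLatticeTreeSelfDualTransitiveTwo      -- ★ `v_det_antidiagonal_two`
import Literature.NumberTheory.Automorphic.UnitaryLatticeTreeTypeTwoChild               -- ★ `isIntMatrix_antidiagonal`
import HarnessLib

/-!
# The lattice tree of `U(σ, J₀)` — THE HYPERBOLIC TYPE-(2) LITERAL `ι(g, u)`, CENTRED AND RE-ROOTED: `Γ = ι(k⁻¹(s·g)k, 1)`, its junction-head slots, and the
# transport of the three (α) block-law ROWS from `ι(g, u)` to `Γ` (Kottwitz 1986 §3; Rogawski 1990 §4.8–§4.9; Bruhat–Tits 1972 §10)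

Topic `NumberTheory/Automorphic`; namespace `Literature.NumberTheory.Automorphic.UnitaryLatticeTree`.  THEOREMS ONLY (no definition, no instance, no notation, no named
fact, no `sorry`); kernel lane `--supports stmt-HodgeConjecture-24833`; generic valued field `K`, any `σ` (the CM dress is the consumer's one `obtain`: `K := L_w`,
`σ := σ_w`, `ι(ĝ_w, û_w)` = the J0diff's own set-builder element, ★ `placeForm_antidiagOne`).  Cell `pub/hodgecm-mathlib` (D-0151), crux H413; road «S3-ram»
(Literature seeding, count-neutral): the (α) BLOCK-LAW skeleton of the (Cnt2′) type-(2) assembly ((α) keeper F0P3a-p06 (g16); v0 cells `stub_T2G_{zero,pm}_{even,odd}_J0diff`,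
A-p19 (g28)), organ «J2-FRAME-hyp» dealt to this seat by chair F0P3a-p07 (g15) RULING (13)(2); CONSUMER: F0P3a-p08 (g20)'s composition cells `stub_Zhyp_{row,par,branch}` (RULING
(13)(6)), over ★ F0P3-p01 (g19)'s generic centring file (the (T2) twin for the OPPOSITE literal) and A-p12 (g25)'s centring conjugator `k` ((4b), W-side).
HONEST LABEL: HC_CM is proved only modulo the 2 remaining named inputs (hLiu418 24832, h413 24833) until rung 0 closes; unconditional local algebra, count-neutral.

THE MATHEMATICS.  The J0diff cell counts self-dual lattices `M` of the `J₀ = Φ₃`-model fixed by the HYPERBOLIC literal `T = ι(g, u)` (`g ∈ U(σ, Φ₂)` 2-deep with rootless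
`χ_g`, `u ∈ U(σ, Φ₁)` 2-deep) with a depth-`≤ 2` token.  The junction head ★ `strataCount_J₀_of_charpoly_block_raw` wants instead an INTEGRAL element of `U(σ, J₀)` whose
`1 × 1` block is `≡ 1` to the top depth `d₀` and whose ROOT `L₀ = 𝒪³` carries the top level.  Two moves, neither of which changes any stratum count: (i) CENTRING by the
norm-one unit `s = u₀₀⁻¹` (`|s − 1| ≤ |ϖ|²`): `T″ = s·T = ι(s·g, 1)` — the five strata SETS of `T` and `T″` coincide (★ p849074 §5; here §3 restates the three ROW shapes the
(α) cells use: deep, `1□_C`, `¬1□_C`); (ii) RE-ROOTING by an axis frame `Q = ι(k, 1)`, `k ∈ U(σ, Φ₂)` (A-p12's centring conjugator, which puts the centre `A₀` of the `W`-ball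
at `L₀`): `T″ = Q·Γ·Q⁻¹` with **`Γ = ι(B₀, 1)`, `B₀ = k⁻¹(s·g)k`**, and conjugation by a unitary `Q` preserves every stratum COUNT (★ `ncard_selfDual_fixed_*_conj_eq_of_mem_
unitaryGroupOfForm`).  §2 then reads off the head's slots AT `Γ`: `Γ ∈ U(σ, J₀)` (blocks unitary, ★ `endoGL_mem_iff`, `Φ₃ = ι-shape(Φ₂, Φ₁)`), `Γ ∈ K₀` and `hroot`
from ONE depth bound `|(B₀ − 1)ᵢⱼ| ≤ |ϖ|^d` (`1 ≤ d`), `hchar : χ_Γ = (X − 1)·χ_{B₀}` (`lam := 1`, `Bm := ↑B₀`), `hlam` trivially, `χ_{B₀}` rootless and `|disc B₀| = |disc g|`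
(centring and conjugation do not touch the spectrum), and `hFfin` at `Γ` (★ A-p19 (g28) `finite_setOf_latticeGraphIso_antidiagonal_eq_of_coe_eq_conj_endoGL`, frame `P = 1`).
* §1 `endoForm_antidiagonal_over` (`Φ₃ = ι-shape(Φ₂, Φ₁)`), `endoGL_mem_unitaryGroupOfForm_antidiagonal_three`, **`scalar_mul_endoGL_eq_conj_rerooted`** (`s·ι(g,u) =
  ι(k,1)·Γ·ι(k,1)⁻¹`), `charpoly_coe_endoGL_one`, `charpoly_coe_rerooted_centred`; §2 **`endoGL_rerootedCentred_mem_unitaryGroupOfForm`** (`Γ ∈ U(σ, J₀)`),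
  **`endoGL_one_mem_unitaryInt`** (`hγ0`), **`map_sub_one_stdLattice_le_scaleLattice_endoGL_one`** (`hroot`), `not_exists_isRoot_charpoly_rerooted_centred` (`hirr`),
  `v_disc_rerooted_centred` (`hdisc`), **`finite_setOf_latticeGraphIso_endoGL_one_antidiagonal`** (`hFfin`); §3 `tokens_iff_of_coe_eq_smul`, the three ROW shapes
  `setOf_{deep,rankOne,rankOneNot}_eq_of_coe_eq_smul`, and the END-TO-END transports **`ncard_{deep,rankOne,rankOneNot}_endoGL_eq_rerooted`**.

## References
* [Kottwitz1986] R. E. Kottwitz, *Base change for unit elements of Hecke algebras*, Compositio Math. 60 (1986), §3 (counting `γ`-fixed lattices; central modifications; conjugation).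
* [Rogawski1990] J. D. Rogawski, *Automorphic Representations of Unitary Groups in Three Variables*, Ann. of Math. Stud. 123 (1990), §4.8 Case (a) p. 53, §4.9 pp. 54–55, Lemma 4.9.3.
* [BruhatTits1972] F. Bruhat, J. Tits, *Groupes réductifs sur un corps local I*, Publ. Math. IHÉS 41 (1972), §10 (the lattice model; isometries; homotheties act trivially).
* [Serre1980Trees] J.-P. Serre, *Trees* (1980), Ch. II §1.1 (lattices, `GL_N(𝒪)`, levels in a basis).  [Serre1979] J.-P. Serre, *Local Fields* (1979), Ch. II §1.
-/

set_option autoImplicit false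

noncomputable section

open scoped Valued WithZero Matrix MatrixGroups
open Polynomial
open Literature.NumberTheory.Automorphic Literature.NumberTheory.Automorphic.HermitianLattice Literature.NumberTheory.Automorphic.UnitaryLatticeTree
open Literature.NumberTheory.Rogawski1990

namespace Literature.NumberTheory.Automorphic.UnitaryLatticeTree

/-! ## §1 Algebra of the pattern, of `Φ₃ = ι-shape(Φ₂, Φ₁)`, and of the re-rooted centred block `B₀ = k⁻¹(s·g)k` -/

section Algebra

variable {K : Type*} [Field K] {σ : K →+* K}

/-- **`Φ₃ = ι-shape(Φ₂, Φ₁)`** in the `StdForm` spelling: `endoForm J₀⁽²⁾ J₀⁽¹⁾ = J₀⁽³⁾` (★ `endoForm_antidiagOne` is the `Matrix.of` spelling). [cite: Rogawski1990, §4.8 Case (a) p. 53] -/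
theorem endoForm_antidiagonal_over :
    endoForm ((StdForm.antidiagonal 2).over K) ((StdForm.antidiagonal 1).over K) = (StdForm.antidiagonal 3).over K := by
  ext i j
  rw [endoForm_eq]
  fin_cases i <;> fin_cases j <;> simp [StdForm.over, StdForm.antidiagonal_J_apply, Fin.rev, Fin.ext_iff]

/-- **`ι(γ₂, u) ∈ U(σ, Φ₃)` from the blocks** `γ₂ ∈ U(σ, Φ₂)`, `u ∈ U(σ, Φ₁)` (★ `endoGL_mem_iff` at `Φ₃ = ι-shape(Φ₂, Φ₁)`). [cite: Rogawski1990, §4.8 Case (a) p. 53] -/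
theorem endoGL_mem_unitaryGroupOfForm_antidiagonal_three {γ₂ : GL (Fin 2) K} {u : GL (Fin 1) K}
    (hγ : γ₂ ∈ unitaryGroupOfForm σ ((StdForm.antidiagonal 2).over K)) (hu : u ∈ unitaryGroupOfForm σ ((StdForm.antidiagonal 1).over K)) :
    endoGL (γ₂, u) ∈ unitaryGroupOfForm σ ((StdForm.antidiagonal 3).over K) := by
  rw [← endoForm_antidiagonal_over, endoGL_mem_iff]
  exact ⟨hγ, hu⟩

/-- `u ∈ U(σ, Φ₁)` says `σ(u₀₀)·u₀₀ = 1` (the middle eigenvalue has norm one). [cite: Rogawski1990, §4.8 Case (a) p. 53] -/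
theorem map_mul_self_eq_one_of_mem_unitaryGroupOfForm_one {u : GL (Fin 1) K} (hu : u ∈ unitaryGroupOfForm σ ((StdForm.antidiagonal 1).over K)) :
    σ ((u : Matrix (Fin 1) (Fin 1) K) 0 0) * (u : Matrix (Fin 1) (Fin 1) K) 0 0 = 1 := by
  rw [mem_unitaryGroupOfForm_iff] at hu
  have h := congr_fun (congr_fun hu 0) 0
  simpa [Matrix.mul_apply, StdForm.over, StdForm.antidiagonal_J_apply] using h

/-- `s·u₀₀ = 1` with `σ(u₀₀)·u₀₀ = 1` gives `σ(s)·s = 1` (★ p849074 `norm_eq_one_of_mul_eq_one_of_norm_eq_one`, restated from `u ∈ U(σ, Φ₁)`). [cite: Rogawski1990, §4.8 Case (a) p. 53] -/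
theorem map_mul_self_eq_one_of_mul_oneByOne_eq_one {u : GL (Fin 1) K} (hu : u ∈ unitaryGroupOfForm σ ((StdForm.antidiagonal 1).over K)) {s : Kˣ}
    (hs : (s : K) * (u : Matrix (Fin 1) (Fin 1) K) 0 0 = 1) : σ (s : K) * s = 1 :=
  norm_eq_one_of_mul_eq_one_of_norm_eq_one (map_mul_self_eq_one_of_mem_unitaryGroupOfForm_one hu) hs

/-- **Re-rooting by an axis frame** (★ `endoGL_inv_mul_endoGL_mul_endoGL`, solved for the middle): `ι(γ₂, u) = ι(k, 1)·ι(k⁻¹γ₂k, u)·ι(k, 1)⁻¹`. [cite: Rogawski1990, §4.8 Case (a) p. 53] -/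
theorem endoGL_eq_conj_endoGL (k γ₂ : GL (Fin 2) K) (u : GL (Fin 1) K) :
    endoGL (γ₂, u) = endoGL (k, (1 : GL (Fin 1) K)) * endoGL (k⁻¹ * γ₂ * k, u) * (endoGL (k, (1 : GL (Fin 1) K)))⁻¹ := by
  rw [← endoGL_inv_mul_endoGL_mul_endoGL, ← mul_assoc, ← mul_assoc, mul_inv_cancel, one_mul, mul_inv_cancel_right]

/-- **THE CENTRED LITERAL AS A CONJUGATE OF THE RE-ROOTED ONE**: for `s·u₀₀ = 1`, `s·ι(g, u) = ι(k, 1) · ι(k⁻¹(s·g)k, 1) · ι(k, 1)⁻¹`.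
[cite: Rogawski1990, §4.8 Case (a) p. 53; §4.9 p. 55] [cite: Kottwitz1986, §3] -/
theorem scalar_mul_endoGL_eq_conj_rerooted (g k : GL (Fin 2) K) (u : GL (Fin 1) K) (s : Kˣ) (hs : (s : K) * (u : Matrix (Fin 1) (Fin 1) K) 0 0 = 1) :
    Matrix.GeneralLinearGroup.scalar (Fin 3) s * endoGL (g, u) =
      endoGL (k, (1 : GL (Fin 1) K)) * endoGL (k⁻¹ * (Matrix.GeneralLinearGroup.scalar (Fin 2) s * g) * k, (1 : GL (Fin 1) K)) * (endoGL (k, (1 : GL (Fin 1) K)))⁻¹ := by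
  rw [← endoGL_scalar_mul_eq_scalar_mul_endoGL g u s hs, ← endoGL_eq_conj_endoGL]

/-- `χ_{ι(γ₂, 1)} = (X − 1)·χ_{γ₂}` (★ `charpoly_coe_endoGL` at `b = 1`) — the head's `hchar` with `lam := 1`. [cite: Rogawski1990, §4.8 Case (a) p. 53; §4.3 p. 42] -/
theorem charpoly_coe_endoGL_one (γ₂ : GL (Fin 2) K) :
    ((endoGL (γ₂, (1 : GL (Fin 1) K)) : GL (Fin 3) K) : Matrix (Fin 3) (Fin 3) K).charpoly = (X - C 1) * (γ₂ : Matrix (Fin 2) (Fin 2) K).charpoly := by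
  rw [charpoly_coe_endoGL, Units.val_one, Matrix.one_apply_eq]

/-- `χ_{B₀} = χ_{s·g}` for `B₀ = k⁻¹(s·g)k` (`Matrix.charpoly_units_conj` at `k⁻¹`). [cite: Rogawski1990, §3.1 p. 19] [cite: Kottwitz1986, §3] -/
theorem charpoly_coe_rerooted_centred (g k : GL (Fin 2) K) (s : Kˣ) :
    ((k⁻¹ * (Matrix.GeneralLinearGroup.scalar (Fin 2) s * g) * k : GL (Fin 2) K) : Matrix (Fin 2) (Fin 2) K).charpoly = ((s : K) • (g : Matrix (Fin 2) (Fin 2) K)).charpoly := by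
  rw [Units.val_mul, Units.val_mul, show ((k : GL (Fin 2) K) : Matrix (Fin 2) (Fin 2) K) = (((k⁻¹)⁻¹ : GL (Fin 2) K) : Matrix (Fin 2) (Fin 2) K) by
    rw [inv_inv], Matrix.coe_units_inv (k⁻¹), Matrix.charpoly_units_conj k⁻¹, coe_scalar_mul_eq_smul]

end Algebra

/-! ## §2 The junction head's slots AT `Γ = ι(B₀, 1)`, `B₀ = k⁻¹(s·g)k` -/

section Slots

variable {K : Type*} [Field K] [Valued K ℤᵐ⁰] {σ : K →+* K} {ϖ : K}

omit [Valued K ℤᵐ⁰] in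
/-- **`Γ = ι(k⁻¹(s·g)k, 1) ∈ U(σ, J₀)`**: `g ∈ U(σ, Φ₂)`, `u ∈ U(σ, Φ₁)`, `s·u₀₀ = 1` (so `σ(s)·s = 1`), `k ∈ U(σ, Φ₂)`. [cite: Rogawski1990, §4.8 Case (a) p. 53] [cite: Kottwitz1986, §3] -/
theorem endoGL_rerootedCentred_mem_unitaryGroupOfForm {g k : GL (Fin 2) K} {u : GL (Fin 1) K} {s : Kˣ}
    (hg : g ∈ unitaryGroupOfForm σ ((StdForm.antidiagonal 2).over K)) (hu : u ∈ unitaryGroupOfForm σ ((StdForm.antidiagonal 1).over K))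
    (hs : (s : K) * (u : Matrix (Fin 1) (Fin 1) K) 0 0 = 1) (hk : k ∈ unitaryGroupOfForm σ ((StdForm.antidiagonal 2).over K)) :
    endoGL (k⁻¹ * (Matrix.GeneralLinearGroup.scalar (Fin 2) s * g) * k, (1 : GL (Fin 1) K)) ∈ unitaryGroupOfForm σ ((StdForm.antidiagonal 3).over K) := by
  refine endoGL_mem_unitaryGroupOfForm_antidiagonal_three ?_ (Subgroup.one_mem _)
  exact Subgroup.mul_mem _ (Subgroup.mul_mem _ (Subgroup.inv_mem _ hk)
    (scalar_mul_mem_unitaryGroupOfForm hg s (map_mul_self_eq_one_of_mul_oneByOne_eq_one hu hs))) hk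

/-- **INTEGRALITY of `Γ = ι(B₀, 1)` and of `Γ⁻¹`** from the depth bound `|(B₀ − 1)ᵢⱼ| ≤ |ϖ|^d`, `1 ≤ d`, `|ϖ| < 1`. [cite: Serre1980Trees, Ch. II §1.1] [cite: Kottwitz1986, §3] -/
theorem isIntMatrix_coe_endoGL_one_of_forall_v_sub_one_le (hϖ : Valued.v ϖ < 1) {B₀ : GL (Fin 2) K} {d : ℕ} (hd1 : 1 ≤ d)
    (hd : ∀ i j, Valued.v (((B₀ : Matrix (Fin 2) (Fin 2) K) - 1) i j) ≤ Valued.v ϖ ^ d) :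
    IsIntMatrix ((endoGL (B₀, (1 : GL (Fin 1) K)) : GL (Fin 3) K) : Matrix (Fin 3) (Fin 3) K) ∧
      IsIntMatrix (((endoGL (B₀, (1 : GL (Fin 1) K)))⁻¹ : GL (Fin 3) K) : Matrix (Fin 3) (Fin 3) K) := by
  have hlt : ∀ i j, Valued.v (((B₀ : Matrix (Fin 2) (Fin 2) K) - 1) i j) < 1 := fun i j =>
    (hd i j).trans_lt (pow_lt_one₀ zero_le hϖ (by omega))
  have hB : IsIntMatrix (B₀ : Matrix (Fin 2) (Fin 2) K) := isIntMatrix_of_forall_v_sub_one_lt_one _ hlt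
  have hBi : IsIntMatrix ((B₀⁻¹ : GL (Fin 2) K) : Matrix (Fin 2) (Fin 2) K) := by
    rw [Matrix.coe_units_inv]; exact isIntMatrix_nonsing_inv_of_forall_v_sub_one_lt_one _ hlt
  refine ⟨(isIntMatrix_coe_endoGL_iff B₀ 1).2 ⟨hB, by simp⟩, ?_⟩
  rw [← map_inv, Prod.inv_mk, inv_one]
  exact (isIntMatrix_coe_endoGL_iff B₀⁻¹ 1).2 ⟨hBi, by simp⟩

/-- **`Γ ∈ K₀ = U(σ, J₀) ∩ GL₃(𝒪)`** (the head's `hγ0`), from `Γ ∈ U(σ, J₀)` and the depth bound. [cite: Kottwitz1986, §3] [cite: Rogawski1990, §4.9 p. 55] -/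
theorem endoGL_one_mem_unitaryInt (hϖ : Valued.v ϖ < 1) {B₀ : GL (Fin 2) K} (hB₀ : endoGL (B₀, (1 : GL (Fin 1) K)) ∈ unitaryGroupOfForm σ ((StdForm.antidiagonal 3).over K))
    {d : ℕ} (hd1 : 1 ≤ d) (hd : ∀ i j, Valued.v (((B₀ : Matrix (Fin 2) (Fin 2) K) - 1) i j) ≤ Valued.v ϖ ^ d) :
    (⟨endoGL (B₀, (1 : GL (Fin 1) K)), hB₀⟩ : unitaryGroupOfForm σ ((StdForm.antidiagonal 3).over K)) ∈ unitaryInt σ ((StdForm.antidiagonal 3).over K) :=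
  mem_unitaryInt_iff.2 (isIntMatrix_coe_endoGL_one_of_forall_v_sub_one_le hϖ hd1 hd)

/-- **`hroot` AT `Γ = ι(B₀, 1)`**: `(Γ − 1)·L₀ ⊆ ϖ^d·L₀` from `|(B₀ − 1)ᵢⱼ| ≤ |ϖ|^d` (★ `map_sub_one_latt_le_scaleLattice_iff` in the frame `1`; the middle block of `Γ − 1`
vanishes). [cite: Serre1980Trees, Ch. II §1.1] [cite: Kottwitz1986, §3] -/
theorem map_sub_one_stdLattice_le_scaleLattice_endoGL_one (hϖ0 : ϖ ≠ 0) {B₀ : GL (Fin 2) K} {d : ℕ}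
    (hd : ∀ i j, Valued.v (((B₀ : Matrix (Fin 2) (Fin 2) K) - 1) i j) ≤ Valued.v ϖ ^ d) :
    (stdLattice K 3).map ((Matrix.toLin' (((endoGL (B₀, (1 : GL (Fin 1) K)) : GL (Fin 3) K) : Matrix (Fin 3) (Fin 3) K) - 1)).restrictScalars 𝒪[K]) ≤
      scaleLattice (ϖ ^ d) (stdLattice K 3) := by
  have h := map_sub_one_latt_le_scaleLattice_iff (pow_ne_zero d hϖ0) (endoGL (B₀, (1 : GL (Fin 1) K))) 1
  rw [Units.val_one, latt_one, inv_one, one_mul, mul_one] at h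
  rw [h, coe_endoGL_sub_one_eq_endoShape, forall_v_endoShape_le_iff, map_pow]
  exact ⟨hd, by simp⟩

omit [Valued K ℤᵐ⁰] in
/-- **`χ_{B₀}` is rootless when `χ_g` is** (`B₀ = k⁻¹(s·g)k`; ★ p849074 `forall_not_isRoot_charpoly_smul`). [cite: Rogawski1990, §4.9 p. 55; §3.1 p. 19] -/
theorem not_exists_isRoot_charpoly_rerooted_centred (g k : GL (Fin 2) K) (s : Kˣ) (hirr : ¬ ∃ x : K, (g : Matrix (Fin 2) (Fin 2) K).charpoly.IsRoot x) :
    ¬ ∃ x : K, ((k⁻¹ * (Matrix.GeneralLinearGroup.scalar (Fin 2) s * g) * k : GL (Fin 2) K) : Matrix (Fin 2) (Fin 2) K).charpoly.IsRoot x := by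
  rw [charpoly_coe_rerooted_centred]
  exact not_exists_isRoot_charpoly_smul s.ne_zero hirr

/-- **The discriminant depth of `B₀ = k⁻¹(s·g)k` is that of `g`** (`|s| = 1`; `Matrix.trace_units_conj'`, `Matrix.det_units_conj'`, ★ `v_trace_sq_sub_four_mul_det_smul`).
[cite: Rogawski1990, §4.9 p. 55] [cite: Kottwitz1986, §3] -/
theorem v_disc_rerooted_centred (g k : GL (Fin 2) K) (s : Kˣ) (hs : Valued.v (s : K) = 1) :
    Valued.v (((k⁻¹ * (Matrix.GeneralLinearGroup.scalar (Fin 2) s * g) * k : GL (Fin 2) K) : Matrix (Fin 2) (Fin 2) K).trace ^ 2 -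
        4 * ((k⁻¹ * (Matrix.GeneralLinearGroup.scalar (Fin 2) s * g) * k : GL (Fin 2) K) : Matrix (Fin 2) (Fin 2) K).det) =
      Valued.v ((g : Matrix (Fin 2) (Fin 2) K).trace ^ 2 - 4 * (g : Matrix (Fin 2) (Fin 2) K).det) := by
  rw [Units.val_mul, Units.val_mul, Matrix.trace_units_conj', Matrix.det_units_conj', coe_scalar_mul_eq_smul, v_trace_sq_sub_four_mul_det_smul hs]

/-- **`hFfin` AT `Γ = ι(B₀, 1)` IN THE `J₀`-MODEL**: finitely many `Γ`-fixed vertices, for `B₀` integral with rootless `χ_{B₀}` (★ A-p19 (g28)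
`finite_setOf_latticeGraphIso_antidiagonal_eq_of_coe_eq_conj_endoGL` at the frame `P = 1`, block form `Φ₂`, middle entry `1`). [cite: Kottwitz1986, §3] [cite: BruhatTits1972, §10] -/
theorem finite_setOf_latticeGraphIso_endoGL_one_antidiagonal [Finite 𝓀[K]] (hvσ : ∀ a, Valued.v (σ a) = Valued.v a)
    (h2 : Valued.v (2 : K) = 1) (hsq : ∀ u : K, Valued.v (u - 1) < 1 → IsSquare u) (hϖ : Valued.v ϖ = WithZero.exp (-1 : ℤ))
    (B₀ : GL (Fin 2) K) (hB : IsIntMatrix (B₀ : Matrix (Fin 2) (Fin 2) K)) (hirr : ∀ x : K, ¬ (B₀ : Matrix (Fin 2) (Fin 2) K).charpoly.IsRoot x)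
    (γ : unitaryGroupOfForm σ ((StdForm.antidiagonal 3).over K)) (hγ : (γ : GL (Fin 3) K) = endoGL (B₀, (1 : GL (Fin 1) K))) :
    {v : {M : Submodule 𝒪[K] (Fin 3 → K) // IsVertex σ ϖ ((StdForm.antidiagonal 3).over K) M} |
      latticeGraphIso σ ϖ ((StdForm.antidiagonal 3).over K) γ v = v}.Finite := by
  have hP : (!![((StdForm.antidiagonal 2).over K) 0 0, 0, ((StdForm.antidiagonal 2).over K) 0 1; 0, (1 : K), 0;
      ((StdForm.antidiagonal 2).over K) 1 0, 0, ((StdForm.antidiagonal 2).over K) 1 1] : Matrix (Fin 3) (Fin 3) K) =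
      (1 : K) • formCongr σ (1 : GL (Fin 3) K) ((StdForm.antidiagonal 3).over K) := by
    rw [one_smul, formCongr, Units.val_one, Matrix.map_one σ (map_zero σ) (map_one σ), Matrix.transpose_one, Matrix.one_mul, Matrix.mul_one,
      ← endoForm_antidiagonal_over, endoForm_eq]
    congr
    simp [StdForm.over, StdForm.antidiagonal_J_apply]
  refine finite_setOf_latticeGraphIso_antidiagonal_eq_of_coe_eq_conj_endoGL hvσ h2 hsq hϖ isIntMatrix_antidiagonal v_det_antidiagonal_two
    (h := (1 : K)) (by rw [map_one]) B₀ hB hirr 1 (by simp) 1 (c := 1) (by rw [map_one]) hP γ ?_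
  rw [hγ, inv_one, one_mul, mul_one]

end Slots

/-! ## §3 The three (α) ROW shapes under centring, and their transport from `ι(g, u)` to `Γ` -/

section Rows

variable {K : Type*} [Field K] [Valued K ℤᵐ⁰] {N : ℕ} {σ : K →+* K} {ϖ : K}

/-- **THE TOKEN DICTIONARY under `↑T″ = s • ↑T`** (`|s| = 1`, `|s − 1| ≤ |ϖ|²`) at one lattice `M`: fixedness, the levels `ϖ`, `ϖ²`, the square token (under `LEV (ϖ)`),
the class token for every constant (at a self-dual `M` under `LEV (ϖ)`) — ★ F0P3a-p05 §1, bundled (★ p849074 §5 proves the five-vector from the same pieces).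
[cite: Kottwitz1986, §3] [cite: Rogawski1990, §4.9 pp. 54–55] -/
theorem tokens_iff_of_coe_eq_smul (hvσ : ∀ a, Valued.v (σ a) = Valued.v a) (hϖ : Valued.v ϖ = WithZero.exp (-1 : ℤ)) (H : Matrix (Fin N) (Fin N) K)
    {s : K} (hs : Valued.v s = 1) (hs1 : Valued.v (s - 1) ≤ Valued.v ϖ ^ 2)
    (T T'' : GL (Fin N) K) (hTT : (T'' : Matrix (Fin N) (Fin N) K) = s • (T : Matrix (Fin N) (Fin N) K)) (M : Submodule 𝒪[K] (Fin N → K)) :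
    (mapGL T'' M = mapGL T M) ∧
    (M.map ((Matrix.toLin' ((T : Matrix (Fin N) (Fin N) K) - 1)).restrictScalars 𝒪[K]) ≤ scaleLattice ϖ M ↔
      M.map ((Matrix.toLin' ((T'' : Matrix (Fin N) (Fin N) K) - 1)).restrictScalars 𝒪[K]) ≤ scaleLattice ϖ M) ∧
    (M.map ((Matrix.toLin' ((T : Matrix (Fin N) (Fin N) K) - 1)).restrictScalars 𝒪[K]) ≤ scaleLattice (ϖ ^ 2) M ↔
      M.map ((Matrix.toLin' ((T'' : Matrix (Fin N) (Fin N) K) - 1)).restrictScalars 𝒪[K]) ≤ scaleLattice (ϖ ^ 2) M) ∧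
    (M.map ((Matrix.toLin' ((T : Matrix (Fin N) (Fin N) K) - 1)).restrictScalars 𝒪[K]) ≤ scaleLattice ϖ M →
      (M.map ((Matrix.toLin' (((T : Matrix (Fin N) (Fin N) K) - 1) ^ 2)).restrictScalars 𝒪[K]) ≤ scaleLattice (ϖ ^ 3) M ↔
        M.map ((Matrix.toLin' (((T'' : Matrix (Fin N) (Fin N) K) - 1) ^ 2)).restrictScalars 𝒪[K]) ≤ scaleLattice (ϖ ^ 3) M)) ∧
    (IsSelfDualLattice σ ϖ H M → M.map ((Matrix.toLin' ((T : Matrix (Fin N) (Fin N) K) - 1)).restrictScalars 𝒪[K]) ≤ scaleLattice ϖ M → ∀ C : K,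
      ((∃ y ∈ M, ∃ a : K, Valued.v a = 1 ∧ Valued.v (ϖ⁻¹ * pairing σ H y (((T : Matrix (Fin N) (Fin N) K) - 1) *ᵥ y) - C * a ^ 2) < 1) ↔
        ∃ y ∈ M, ∃ a : K, Valued.v a = 1 ∧ Valued.v (ϖ⁻¹ * pairing σ H y (((T'' : Matrix (Fin N) (Fin N) K) - 1) *ᵥ y) - C * a ^ 2) < 1)) := by
  have hϖ0 : ϖ ≠ 0 := fun h0 => by rw [h0, map_zero] at hϖ; exact WithZero.coe_ne_zero hϖ.symm
  have hϖ1 : Valued.v ϖ ≤ 1 := by rw [hϖ, ← WithZero.exp_zero]; exact WithZero.exp_le_exp.2 (by norm_num)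
  have hs0 : s ≠ 0 := fun h => by rw [h, map_zero] at hs; exact zero_ne_one hs
  have hB1 : (T'' : Matrix (Fin N) (Fin N) K) - 1 = s • ((T : Matrix (Fin N) (Fin N) K) - 1) + (s - 1) • (1 : Matrix (Fin N) (Fin N) K) := by
    rw [hTT, smul_sub, sub_smul, one_smul]; abel
  have hB2 : (T : Matrix (Fin N) (Fin N) K) - 1 = s⁻¹ • ((T'' : Matrix (Fin N) (Fin N) K) - 1) + (s⁻¹ - 1) • (1 : Matrix (Fin N) (Fin N) K) := by
    rw [hTT, smul_sub, smul_smul, inv_mul_cancel₀ hs0, one_smul, sub_smul, one_smul]; abel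
  have hsi : Valued.v s⁻¹ = 1 := by rw [map_inv₀, hs, inv_one]
  have hsi1 : Valued.v (s⁻¹ - 1) ≤ Valued.v ϖ ^ 2 := by
    rw [show s⁻¹ - 1 = s⁻¹ * (1 - s) by rw [mul_sub, mul_one, inv_mul_cancel₀ hs0], map_mul, hsi, one_mul, ← Valuation.map_neg, neg_sub]
    exact hs1
  have hϖ21 : Valued.v ϖ ^ 2 ≤ Valued.v ϖ := by rw [pow_two]; exact mul_le_of_le_one_left zero_le hϖ1
  have hL : ∀ k : ℕ, k = 1 ∨ k = 2 →
      (M.map ((Matrix.toLin' ((T : Matrix (Fin N) (Fin N) K) - 1)).restrictScalars 𝒪[K]) ≤ scaleLattice (ϖ ^ k) M ↔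
        M.map ((Matrix.toLin' ((T'' : Matrix (Fin N) (Fin N) K) - 1)).restrictScalars 𝒪[K]) ≤ scaleLattice (ϖ ^ k) M) := by
    intro k hk
    have hk' : Valued.v ϖ ^ 2 ≤ Valued.v (ϖ ^ k) := by
      rcases hk with rfl | rfl
      · rw [pow_one]; exact hϖ21
      · rw [map_pow]
    exact ⟨map_toLin'_le_scaleLattice_of_eq_smul_add_smul hB1 hs.le (pow_ne_zero _ hϖ0) (hs1.trans hk') M,
      map_toLin'_le_scaleLattice_of_eq_smul_add_smul hB2 hsi.le (pow_ne_zero _ hϖ0) (hsi1.trans hk') M⟩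
  have hL1 : (M.map ((Matrix.toLin' ((T : Matrix (Fin N) (Fin N) K) - 1)).restrictScalars 𝒪[K]) ≤ scaleLattice ϖ M ↔
        M.map ((Matrix.toLin' ((T'' : Matrix (Fin N) (Fin N) K) - 1)).restrictScalars 𝒪[K]) ≤ scaleLattice ϖ M) := by
    have h := hL 1 (Or.inl rfl); rwa [pow_one] at h
  refine ⟨mapGL_eq_of_coe_eq_smul hs hTT M, hL1, hL 2 (Or.inr rfl), fun h1 => ?_, fun hSD h1 C => ?_⟩
  · exact ⟨map_toLin'_sq_le_scaleLattice_of_eq_smul_add_smul hϖ hB1 hs.le hs1 M h1,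
      map_toLin'_sq_le_scaleLattice_of_eq_smul_add_smul hϖ hB2 hsi.le hsi1 M (hL1.1 h1)⟩
  · refine exists_congr fun y => and_congr_right fun hy => exists_congr fun a => and_congr_right fun _ => ?_
    exact (v_inv_mul_pairing_sub_lt_one_iff_of_eq_smul_add_smul hϖ σ H hB1 hs1 hs1
      (v_pairing_mulVec_le_of_map_le_scaleLattice hvσ hSD hϖ0 h1 hy) (v_pairing_self_le_one hvσ hSD hy) (C * a ^ 2)).symm

/-- **ROW `zero` (the deep stratum `LEV (ϖ²)`) under a 2-deep unit central rescaling**, as a SET equality. [cite: Kottwitz1986, §3] [cite: Rogawski1990, §4.9 p. 55] -/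
theorem setOf_deep_eq_of_coe_eq_smul (hvσ : ∀ a, Valued.v (σ a) = Valued.v a) (hϖ : Valued.v ϖ = WithZero.exp (-1 : ℤ)) (H : Matrix (Fin N) (Fin N) K)
    {s : K} (hs : Valued.v s = 1) (hs1 : Valued.v (s - 1) ≤ Valued.v ϖ ^ 2)
    (T T'' : GL (Fin N) K) (hTT : (T'' : Matrix (Fin N) (Fin N) K) = s • (T : Matrix (Fin N) (Fin N) K)) :
    {M : Submodule 𝒪[K] (Fin N → K) | IsSelfDualLattice σ ϖ H M ∧ mapGL T'' M = M ∧
        M.map ((Matrix.toLin' ((T'' : Matrix (Fin N) (Fin N) K) - 1)).restrictScalars 𝒪[K]) ≤ scaleLattice (ϖ ^ 2) M} =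
      {M : Submodule 𝒪[K] (Fin N → K) | IsSelfDualLattice σ ϖ H M ∧ mapGL T M = M ∧
        M.map ((Matrix.toLin' ((T : Matrix (Fin N) (Fin N) K) - 1)).restrictScalars 𝒪[K]) ≤ scaleLattice (ϖ ^ 2) M} := by
  ext M
  obtain ⟨hfix, -, hL2, -, -⟩ := tokens_iff_of_coe_eq_smul hvσ hϖ H hs hs1 T T'' hTT M
  simp only [Set.mem_setOf_eq]
  rw [hfix, hL2]

/-- **ROW `1□_C`** (`LEV (ϖ)`, `¬LEV (ϖ²)`, `LEV₂ (ϖ³)`, class token of constant `C`) under a 2-deep unit central rescaling, as a SET equality.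
[cite: Kottwitz1986, §3] [cite: Rogawski1990, §4.9 p. 55] -/
theorem setOf_rankOne_eq_of_coe_eq_smul (hvσ : ∀ a, Valued.v (σ a) = Valued.v a) (hϖ : Valued.v ϖ = WithZero.exp (-1 : ℤ)) (H : Matrix (Fin N) (Fin N) K)
    {s : K} (hs : Valued.v s = 1) (hs1 : Valued.v (s - 1) ≤ Valued.v ϖ ^ 2)
    (T T'' : GL (Fin N) K) (hTT : (T'' : Matrix (Fin N) (Fin N) K) = s • (T : Matrix (Fin N) (Fin N) K)) (C : K) :
    {M : Submodule 𝒪[K] (Fin N → K) | IsSelfDualLattice σ ϖ H M ∧ mapGL T'' M = M ∧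
        (M.map ((Matrix.toLin' ((T'' : Matrix (Fin N) (Fin N) K) - 1)).restrictScalars 𝒪[K]) ≤ scaleLattice ϖ M ∧
          ¬ M.map ((Matrix.toLin' ((T'' : Matrix (Fin N) (Fin N) K) - 1)).restrictScalars 𝒪[K]) ≤ scaleLattice (ϖ ^ 2) M ∧
            M.map ((Matrix.toLin' (((T'' : Matrix (Fin N) (Fin N) K) - 1) ^ 2)).restrictScalars 𝒪[K]) ≤ scaleLattice (ϖ ^ 3) M ∧
              ∃ y ∈ M, ∃ a : K, Valued.v a = 1 ∧
                Valued.v (ϖ⁻¹ * pairing σ H y (((T'' : Matrix (Fin N) (Fin N) K) - 1) *ᵥ y) - C * a ^ 2) < 1)} =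
      {M : Submodule 𝒪[K] (Fin N → K) | IsSelfDualLattice σ ϖ H M ∧ mapGL T M = M ∧
        (M.map ((Matrix.toLin' ((T : Matrix (Fin N) (Fin N) K) - 1)).restrictScalars 𝒪[K]) ≤ scaleLattice ϖ M ∧
          ¬ M.map ((Matrix.toLin' ((T : Matrix (Fin N) (Fin N) K) - 1)).restrictScalars 𝒪[K]) ≤ scaleLattice (ϖ ^ 2) M ∧
            M.map ((Matrix.toLin' (((T : Matrix (Fin N) (Fin N) K) - 1) ^ 2)).restrictScalars 𝒪[K]) ≤ scaleLattice (ϖ ^ 3) M ∧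
              ∃ y ∈ M, ∃ a : K, Valued.v a = 1 ∧
                Valued.v (ϖ⁻¹ * pairing σ H y (((T : Matrix (Fin N) (Fin N) K) - 1) *ᵥ y) - C * a ^ 2) < 1)} := by
  ext M
  obtain ⟨hfix, hL1, hL2, hS, hC⟩ := tokens_iff_of_coe_eq_smul hvσ hϖ H hs hs1 T T'' hTT M
  simp only [Set.mem_setOf_eq]
  rw [hfix]
  refine and_congr_right fun hSD => and_congr_right fun _ => ?_
  exact ⟨fun ⟨h1, h2, h3, h4⟩ => ⟨hL1.2 h1, fun h => h2 (hL2.1 h), (hS (hL1.2 h1)).2 h3, (hC hSD (hL1.2 h1) C).2 h4⟩,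
    fun ⟨h1, h2, h3, h4⟩ => ⟨hL1.1 h1, fun h => h2 (hL2.2 h), (hS h1).1 h3, (hC hSD h1 C).1 h4⟩⟩

/-- **ROW `¬1□_C`** (same level tokens, NEGATED class token) under a 2-deep unit central rescaling, as a SET equality. [cite: Kottwitz1986, §3] [cite: Rogawski1990, §4.9 p. 55] -/
theorem setOf_rankOneNot_eq_of_coe_eq_smul (hvσ : ∀ a, Valued.v (σ a) = Valued.v a) (hϖ : Valued.v ϖ = WithZero.exp (-1 : ℤ)) (H : Matrix (Fin N) (Fin N) K)
    {s : K} (hs : Valued.v s = 1) (hs1 : Valued.v (s - 1) ≤ Valued.v ϖ ^ 2)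
    (T T'' : GL (Fin N) K) (hTT : (T'' : Matrix (Fin N) (Fin N) K) = s • (T : Matrix (Fin N) (Fin N) K)) (C : K) :
    {M : Submodule 𝒪[K] (Fin N → K) | IsSelfDualLattice σ ϖ H M ∧ mapGL T'' M = M ∧
        (M.map ((Matrix.toLin' ((T'' : Matrix (Fin N) (Fin N) K) - 1)).restrictScalars 𝒪[K]) ≤ scaleLattice ϖ M ∧
          ¬ M.map ((Matrix.toLin' ((T'' : Matrix (Fin N) (Fin N) K) - 1)).restrictScalars 𝒪[K]) ≤ scaleLattice (ϖ ^ 2) M ∧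
            M.map ((Matrix.toLin' (((T'' : Matrix (Fin N) (Fin N) K) - 1) ^ 2)).restrictScalars 𝒪[K]) ≤ scaleLattice (ϖ ^ 3) M ∧
              ¬ ∃ y ∈ M, ∃ a : K, Valued.v a = 1 ∧
                Valued.v (ϖ⁻¹ * pairing σ H y (((T'' : Matrix (Fin N) (Fin N) K) - 1) *ᵥ y) - C * a ^ 2) < 1)} =
      {M : Submodule 𝒪[K] (Fin N → K) | IsSelfDualLattice σ ϖ H M ∧ mapGL T M = M ∧
        (M.map ((Matrix.toLin' ((T : Matrix (Fin N) (Fin N) K) - 1)).restrictScalars 𝒪[K]) ≤ scaleLattice ϖ M ∧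
          ¬ M.map ((Matrix.toLin' ((T : Matrix (Fin N) (Fin N) K) - 1)).restrictScalars 𝒪[K]) ≤ scaleLattice (ϖ ^ 2) M ∧
            M.map ((Matrix.toLin' (((T : Matrix (Fin N) (Fin N) K) - 1) ^ 2)).restrictScalars 𝒪[K]) ≤ scaleLattice (ϖ ^ 3) M ∧
              ¬ ∃ y ∈ M, ∃ a : K, Valued.v a = 1 ∧
                Valued.v (ϖ⁻¹ * pairing σ H y (((T : Matrix (Fin N) (Fin N) K) - 1) *ᵥ y) - C * a ^ 2) < 1)} := by
  ext M
  obtain ⟨hfix, hL1, hL2, hS, hC⟩ := tokens_iff_of_coe_eq_smul hvσ hϖ H hs hs1 T T'' hTT M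
  simp only [Set.mem_setOf_eq]
  rw [hfix]
  refine and_congr_right fun hSD => and_congr_right fun _ => ?_
  exact ⟨fun ⟨h1, h2, h3, h4⟩ => ⟨hL1.2 h1, fun h => h2 (hL2.1 h), (hS (hL1.2 h1)).2 h3, fun h => h4 ((hC hSD (hL1.2 h1) C).1 h)⟩,
    fun ⟨h1, h2, h3, h4⟩ => ⟨hL1.1 h1, fun h => h2 (hL2.2 h), (hS h1).1 h3, fun h => h4 ((hC hSD h1 C).2 h)⟩⟩

/-- **THE HYPERBOLIC ROW `zero` IN THE `J₀`-MODEL, `ι(g, u) ↦ Γ = ι(k⁻¹(s·g)k, 1)`**: centring (SET equality) then re-rooting by the unitary `ι(k, 1)` (COUNT equality):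
`#{M ∣ SD ∧ ι(g,u)·M = M ∧ LEV (ϖ²)} = #{M ∣ SD ∧ Γ·M = M ∧ LEV (ϖ²)}`.  Needs only `|u₀₀| = 1`, `|u₀₀ − 1| ≤ |ϖ|²`, `s·u₀₀ = 1`, `k ∈ U(σ, Φ₂)`.
[cite: Kottwitz1986, §3] [cite: Rogawski1990, §4.9 pp. 54–55, Lemma 4.9.3] [cite: BruhatTits1972, §10] -/
theorem ncard_deep_endoGL_eq_rerooted (hvσ : ∀ a, Valued.v (σ a) = Valued.v a) (hϖ : Valued.v ϖ = WithZero.exp (-1 : ℤ))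
    (g k : GL (Fin 2) K) (u : GL (Fin 1) K) (s : Kˣ)
    (hu1 : Valued.v ((u : Matrix (Fin 1) (Fin 1) K) 0 0) = 1) (hu2 : Valued.v ((u : Matrix (Fin 1) (Fin 1) K) 0 0 - 1) ≤ Valued.v ϖ ^ 2)
    (hs : (s : K) * (u : Matrix (Fin 1) (Fin 1) K) 0 0 = 1) (hk : k ∈ unitaryGroupOfForm σ ((StdForm.antidiagonal 2).over K)) :
    {M : Submodule 𝒪[K] (Fin 3 → K) | IsSelfDualLattice σ ϖ ((StdForm.antidiagonal 3).over K) M ∧ mapGL (endoGL (g, u)) M = M ∧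
        M.map ((Matrix.toLin' (((endoGL (g, u) : GL (Fin 3) K) : Matrix (Fin 3) (Fin 3) K) - 1)).restrictScalars 𝒪[K]) ≤ scaleLattice (ϖ ^ 2) M}.ncard =
      {M : Submodule 𝒪[K] (Fin 3 → K) | IsSelfDualLattice σ ϖ ((StdForm.antidiagonal 3).over K) M ∧
        mapGL (endoGL (k⁻¹ * (Matrix.GeneralLinearGroup.scalar (Fin 2) s * g) * k, (1 : GL (Fin 1) K))) M = M ∧
        M.map ((Matrix.toLin' (((endoGL (k⁻¹ * (Matrix.GeneralLinearGroup.scalar (Fin 2) s * g) * k, (1 : GL (Fin 1) K)) : GL (Fin 3) K) :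
          Matrix (Fin 3) (Fin 3) K) - 1)).restrictScalars 𝒪[K]) ≤ scaleLattice (ϖ ^ 2) M}.ncard := by
  obtain ⟨hsv, hs1⟩ := v_eq_one_and_v_sub_one_le_of_mul_eq_one hu1 hu2 hs
  have hQ : endoGL (k, (1 : GL (Fin 1) K)) ∈ unitaryGroupOfForm σ ((StdForm.antidiagonal 3).over K) :=
    endoGL_mem_unitaryGroupOfForm_antidiagonal_three hk (Subgroup.one_mem _)
  rw [← setOf_deep_eq_of_coe_eq_smul hvσ hϖ ((StdForm.antidiagonal 3).over K) hsv hs1 (endoGL (g, u))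
    (Matrix.GeneralLinearGroup.scalar (Fin 3) s * endoGL (g, u)) (coe_scalar_mul_eq_smul s _), scalar_mul_endoGL_eq_conj_rerooted g k u s hs]
  exact ncard_selfDual_fixed_deep_conj_eq_of_mem_unitaryGroupOfForm σ ϖ _ hQ _

/-- **THE HYPERBOLIC ROW `1□_C` IN THE `J₀`-MODEL, `ι(g, u) ↦ Γ`** (normaliser `ϖ⁻¹`, any class constant `C`). [cite: Kottwitz1986, §3] [cite: Rogawski1990, §4.9 pp. 54–55, Lemma 4.9.3] -/
theorem ncard_rankOne_endoGL_eq_rerooted (hvσ : ∀ a, Valued.v (σ a) = Valued.v a) (hϖ : Valued.v ϖ = WithZero.exp (-1 : ℤ))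
    (g k : GL (Fin 2) K) (u : GL (Fin 1) K) (s : Kˣ)
    (hu1 : Valued.v ((u : Matrix (Fin 1) (Fin 1) K) 0 0) = 1) (hu2 : Valued.v ((u : Matrix (Fin 1) (Fin 1) K) 0 0 - 1) ≤ Valued.v ϖ ^ 2)
    (hs : (s : K) * (u : Matrix (Fin 1) (Fin 1) K) 0 0 = 1) (hk : k ∈ unitaryGroupOfForm σ ((StdForm.antidiagonal 2).over K)) (C : K) :
    {M : Submodule 𝒪[K] (Fin 3 → K) | IsSelfDualLattice σ ϖ ((StdForm.antidiagonal 3).over K) M ∧ mapGL (endoGL (g, u)) M = M ∧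
        (M.map ((Matrix.toLin' (((endoGL (g, u) : GL (Fin 3) K) : Matrix (Fin 3) (Fin 3) K) - 1)).restrictScalars 𝒪[K]) ≤ scaleLattice ϖ M ∧
          ¬ M.map ((Matrix.toLin' (((endoGL (g, u) : GL (Fin 3) K) : Matrix (Fin 3) (Fin 3) K) - 1)).restrictScalars 𝒪[K]) ≤ scaleLattice (ϖ ^ 2) M ∧
            M.map ((Matrix.toLin' ((((endoGL (g, u) : GL (Fin 3) K) : Matrix (Fin 3) (Fin 3) K) - 1) ^ 2)).restrictScalars 𝒪[K]) ≤ scaleLattice (ϖ ^ 3) M ∧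
              ∃ y ∈ M, ∃ a : K, Valued.v a = 1 ∧
                Valued.v (ϖ⁻¹ * pairing σ ((StdForm.antidiagonal 3).over K) y ((((endoGL (g, u) : GL (Fin 3) K) : Matrix (Fin 3) (Fin 3) K) - 1) *ᵥ y) - C * a ^ 2) < 1)}.ncard =
      {M : Submodule 𝒪[K] (Fin 3 → K) | IsSelfDualLattice σ ϖ ((StdForm.antidiagonal 3).over K) M ∧
        mapGL (endoGL (k⁻¹ * (Matrix.GeneralLinearGroup.scalar (Fin 2) s * g) * k, (1 : GL (Fin 1) K))) M = M ∧
        (M.map ((Matrix.toLin' (((endoGL (k⁻¹ * (Matrix.GeneralLinearGroup.scalar (Fin 2) s * g) * k, (1 : GL (Fin 1) K)) : GL (Fin 3) K) :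
            Matrix (Fin 3) (Fin 3) K) - 1)).restrictScalars 𝒪[K]) ≤ scaleLattice ϖ M ∧
          ¬ M.map ((Matrix.toLin' (((endoGL (k⁻¹ * (Matrix.GeneralLinearGroup.scalar (Fin 2) s * g) * k, (1 : GL (Fin 1) K)) : GL (Fin 3) K) :
            Matrix (Fin 3) (Fin 3) K) - 1)).restrictScalars 𝒪[K]) ≤ scaleLattice (ϖ ^ 2) M ∧
            M.map ((Matrix.toLin' ((((endoGL (k⁻¹ * (Matrix.GeneralLinearGroup.scalar (Fin 2) s * g) * k, (1 : GL (Fin 1) K)) : GL (Fin 3) K) :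
              Matrix (Fin 3) (Fin 3) K) - 1) ^ 2)).restrictScalars 𝒪[K]) ≤ scaleLattice (ϖ ^ 3) M ∧
              ∃ y ∈ M, ∃ a : K, Valued.v a = 1 ∧
                Valued.v (ϖ⁻¹ * pairing σ ((StdForm.antidiagonal 3).over K) y
                  ((((endoGL (k⁻¹ * (Matrix.GeneralLinearGroup.scalar (Fin 2) s * g) * k, (1 : GL (Fin 1) K)) : GL (Fin 3) K) :
                    Matrix (Fin 3) (Fin 3) K) - 1) *ᵥ y) - C * a ^ 2) < 1)}.ncard := by
  obtain ⟨hsv, hs1⟩ := v_eq_one_and_v_sub_one_le_of_mul_eq_one hu1 hu2 hs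
  have hQ : endoGL (k, (1 : GL (Fin 1) K)) ∈ unitaryGroupOfForm σ ((StdForm.antidiagonal 3).over K) :=
    endoGL_mem_unitaryGroupOfForm_antidiagonal_three hk (Subgroup.one_mem _)
  rw [← setOf_rankOne_eq_of_coe_eq_smul hvσ hϖ ((StdForm.antidiagonal 3).over K) hsv hs1 (endoGL (g, u))
    (Matrix.GeneralLinearGroup.scalar (Fin 3) s * endoGL (g, u)) (coe_scalar_mul_eq_smul s _) C, scalar_mul_endoGL_eq_conj_rerooted g k u s hs]
  exact ncard_selfDual_fixed_rankOne_conj_eq_of_mem_unitaryGroupOfForm σ ϖ _ hQ _ ϖ⁻¹ C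

/-- **THE HYPERBOLIC ROW `¬1□_C` IN THE `J₀`-MODEL, `ι(g, u) ↦ Γ`** (normaliser `ϖ⁻¹`, any class constant `C`). [cite: Kottwitz1986, §3] [cite: Rogawski1990, §4.9 pp. 54–55, Lemma 4.9.3] -/
theorem ncard_rankOneNot_endoGL_eq_rerooted (hvσ : ∀ a, Valued.v (σ a) = Valued.v a) (hϖ : Valued.v ϖ = WithZero.exp (-1 : ℤ))
    (g k : GL (Fin 2) K) (u : GL (Fin 1) K) (s : Kˣ)
    (hu1 : Valued.v ((u : Matrix (Fin 1) (Fin 1) K) 0 0) = 1) (hu2 : Valued.v ((u : Matrix (Fin 1) (Fin 1) K) 0 0 - 1) ≤ Valued.v ϖ ^ 2)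
    (hs : (s : K) * (u : Matrix (Fin 1) (Fin 1) K) 0 0 = 1) (hk : k ∈ unitaryGroupOfForm σ ((StdForm.antidiagonal 2).over K)) (C : K) :
    {M : Submodule 𝒪[K] (Fin 3 → K) | IsSelfDualLattice σ ϖ ((StdForm.antidiagonal 3).over K) M ∧ mapGL (endoGL (g, u)) M = M ∧
        (M.map ((Matrix.toLin' (((endoGL (g, u) : GL (Fin 3) K) : Matrix (Fin 3) (Fin 3) K) - 1)).restrictScalars 𝒪[K]) ≤ scaleLattice ϖ M ∧
          ¬ M.map ((Matrix.toLin' (((endoGL (g, u) : GL (Fin 3) K) : Matrix (Fin 3) (Fin 3) K) - 1)).restrictScalars 𝒪[K]) ≤ scaleLattice (ϖ ^ 2) M ∧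
            M.map ((Matrix.toLin' ((((endoGL (g, u) : GL (Fin 3) K) : Matrix (Fin 3) (Fin 3) K) - 1) ^ 2)).restrictScalars 𝒪[K]) ≤ scaleLattice (ϖ ^ 3) M ∧
              ¬ ∃ y ∈ M, ∃ a : K, Valued.v a = 1 ∧
                Valued.v (ϖ⁻¹ * pairing σ ((StdForm.antidiagonal 3).over K) y ((((endoGL (g, u) : GL (Fin 3) K) : Matrix (Fin 3) (Fin 3) K) - 1) *ᵥ y) - C * a ^ 2) < 1)}.ncard =
      {M : Submodule 𝒪[K] (Fin 3 → K) | IsSelfDualLattice σ ϖ ((StdForm.antidiagonal 3).over K) M ∧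
        mapGL (endoGL (k⁻¹ * (Matrix.GeneralLinearGroup.scalar (Fin 2) s * g) * k, (1 : GL (Fin 1) K))) M = M ∧
        (M.map ((Matrix.toLin' (((endoGL (k⁻¹ * (Matrix.GeneralLinearGroup.scalar (Fin 2) s * g) * k, (1 : GL (Fin 1) K)) : GL (Fin 3) K) :
            Matrix (Fin 3) (Fin 3) K) - 1)).restrictScalars 𝒪[K]) ≤ scaleLattice ϖ M ∧
          ¬ M.map ((Matrix.toLin' (((endoGL (k⁻¹ * (Matrix.GeneralLinearGroup.scalar (Fin 2) s * g) * k, (1 : GL (Fin 1) K)) : GL (Fin 3) K) :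
            Matrix (Fin 3) (Fin 3) K) - 1)).restrictScalars 𝒪[K]) ≤ scaleLattice (ϖ ^ 2) M ∧
            M.map ((Matrix.toLin' ((((endoGL (k⁻¹ * (Matrix.GeneralLinearGroup.scalar (Fin 2) s * g) * k, (1 : GL (Fin 1) K)) : GL (Fin 3) K) :
              Matrix (Fin 3) (Fin 3) K) - 1) ^ 2)).restrictScalars 𝒪[K]) ≤ scaleLattice (ϖ ^ 3) M ∧
              ¬ ∃ y ∈ M, ∃ a : K, Valued.v a = 1 ∧
                Valued.v (ϖ⁻¹ * pairing σ ((StdForm.antidiagonal 3).over K) y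
                  ((((endoGL (k⁻¹ * (Matrix.GeneralLinearGroup.scalar (Fin 2) s * g) * k, (1 : GL (Fin 1) K)) : GL (Fin 3) K) :
                    Matrix (Fin 3) (Fin 3) K) - 1) *ᵥ y) - C * a ^ 2) < 1)}.ncard := by
  obtain ⟨hsv, hs1⟩ := v_eq_one_and_v_sub_one_le_of_mul_eq_one hu1 hu2 hs
  have hQ : endoGL (k, (1 : GL (Fin 1) K)) ∈ unitaryGroupOfForm σ ((StdForm.antidiagonal 3).over K) :=
    endoGL_mem_unitaryGroupOfForm_antidiagonal_three hk (Subgroup.one_mem _)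
  rw [← setOf_rankOneNot_eq_of_coe_eq_smul hvσ hϖ ((StdForm.antidiagonal 3).over K) hsv hs1 (endoGL (g, u))
    (Matrix.GeneralLinearGroup.scalar (Fin 3) s * endoGL (g, u)) (coe_scalar_mul_eq_smul s _) C, scalar_mul_endoGL_eq_conj_rerooted g k u s hs]
  exact ncard_selfDual_fixed_rankOneNot_conj_eq_of_mem_unitaryGroupOfForm σ ϖ _ hQ _ ϖ⁻¹ C

end Rows

end Literature.NumberTheory.Automorphic.UnitaryLatticeTree

end
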